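import Summits.QuantumFields.YangMills.Theorems.BalabanUVNodesN11Sect3SupplyChainRows
import Summits.QuantumFields.YangMills.Theorems.BalabanUVNodesN11ThmP245OfSect3SupplyRAssumedCoPH

/-!
# DAG node N11 — THEOREM 1 OF [III] ALONG dag-n11-e's WITNESS CHAIN AT A GENERIC v1.7 PARAMETER `θ`, THE 𝐑-STEP DISPLAYED AS THE ONE WITNESS-LEVEL HYPOTHESIS THE CHAIN
# CONSUMES — (𝐑ʷ) «𝐑 keeps the 𝐓-image witness» — instead of the live-selector line; its relation to [III]'s p. 244 object `ROpLeaf (VOfRecord₁₃CoPH θ p)` ((𝐑ʷ) ⇒ the leaf ⇒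
# `B14.RAssumedP244`; NOT conversely); the node faces; the ChainRows twin; and (𝐑ʷ) inhabited on the live-selector line (A6)

HEADER — WORK-UNIT METADATA.  Cell `pub-ymgap`, YM-PLAN Track A (HUMAN RULING D-0062 ∕ D-0149 width seats), seat `pub-ymgap-dag-n11-w3` (g2; WIDTH SEAT 3∕4 on NODE n11 [B14],
director-ym №197), route `BalabanUVNodes` (v1.7 `CoPH` key), item K1⁷ `StabilityBAtRecordR13SepCoPH` = stmt-QuantumFields-20542 (helper lane `--kind proof --supports 20542 --as helper`,
count-neutral).  THE ITEM: dag-n11-e g16's HAND-OUT «Y₂» (cell bus 2026-08-28 ≈01:22Z): «the p.244-keyed ∕ `ROpLeaf (VOfRecord₁₃CoPH θ p)`-keyed twin of p591271 `sLaw₁₃CoPH_all_of_chain` and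
of p592483 `sLaw₁₃CoPH_all_of_chain_of_rows`».  [III] = [Balaban1988Convergent], [IV] = [Balaban1989LargeFieldI], [B16] = [Balaban1989LargeFieldII].
Over dag-n11-e's `…Sect3SupplyChainDefs ∕ …Chain ∕ …ChainRows` (p591185 ∕ p591271 ∕ p592483: `Sect3Supplier`, `chainWitness`, `NewEClausesAt`, `PresentChildObligations`,
`NoExpansionClauseFor`, `baseWitness_form`, `formT_spliceTermsB_of_rows`, `formAtZS_succ_of_formT_of_liveSel_of_rstep`, `noExpansionClauseFor_of_form_of_local_of_rows`), def-T's
`Node00/Record13CoPH` (`sLaw₁₃CoPH_iff`, `tLaw₁₃CoPH_iff`, `rOpLeaf_VOfRecord₁₃CoPH_iff`, `thm1Printed_datumOfRecord₁₃CoPH_of_tLaw_rOpLeaf`), `…B16RLeafRecord13LiveCoPH` (p540794) and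
`…B14NodeKnitRecord13RCoPH` (p543669: `rOpLeaf₁₃CoPH_iff_rAssumedP244`).

THE READING POINT (why this is not a one-line re-key like this seat's p583556 ∕ p592685).  p591271's chain reads its 𝐑-input AT WITNESS LEVEL: `formAtZS_succ_of_formT_of_liveSel_of_rstep`
turns the chain's 𝐓-image witness `(tT, EkT)` at level `k` (laws `Sect2.LawsT … k`, the 𝐓-image clause over `slotsTOfRecord … (k+1)`) into a §2 witness of `ρ_{k+1}` WITH THE SAME TERM
VALUES AND CONSTANTS (laws `Sect2.LawsRT … (k+1)`, the clause over `slotsOfRecord … (k+1)`) — on the live-selector line 𝐑 of record integrates out dead sequences and is the identity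
on live ones — and `chainWitness θ p σ (k+1) := splice_k (chainWitness k) (σ k …)` BUILDS «𝐑 keeps the witness» INTO THE DEFINITION of the chain.  [III]'s p. 244 object at the record,
`ROpLeaf (VOfRecord₁₃CoPH θ p) ⟺ ∀ k < K, TLaw₁₃CoPH θ p k → SLaw₁₃CoPH θ p (k+1)` (def-T), is LAW-level: `SLaw ∕ TLaw` hide the witness behind `∃` (`sLaw₁₃CoPH_iff ∕ tLaw₁₃CoPH_iff`),
so from the chain's 𝐓-witness it yields SOME §2 witness of `ρ_{k+1}`, not the splice — re-keying `formAtZS_chainWitness` on it would re-expose an ARBITRARY witness at `k+1`, the very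
pathology the chain removes.  HENCE THIS FILE DISPLAYS THE 𝐑-STEP AT WITNESS LEVEL, as the one hypothesis
  (𝐑ʷ)  `∀ k < K, ∀ tT EkT, FormT_k(tT, EkT) → FormS_{k+1}(tT, EkT)`
([III] p. 244 L36–38 — «we will only assume that [𝐑] has some properties incorporated in the inductive description of the effective actions» — read for THE GIVEN 𝐓-image witness;
print's 𝐑 of [IV] (0.4)–(0.6) also ADDS its own level-`(k+1)` terms, so (𝐑ʷ) with the SAME terms is the tree's live-line modelling made explicit and is STRONGER than the law-level
leaf: §1 proves (𝐑ʷ) ⇒ `ROpLeaf (VOfRecord₁₃CoPH θ p)` ⇒ `B14.RAssumedP244 …`; the converse is not claimed and does not hold in general), generic `θ` — NO selector clause, NO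
admissibility, NO `κ ∕ E₀` sign on the 𝐑-side — and §0 shows (𝐑ʷ) INHABITED on the live-selector line by p591271 §1 (A6).

WHAT THIS FILE PROVES (0 `def`, 0 `sorry`, standard axioms; every proof a composition of the tree theorems named above; hypotheses are Mathlib-style section variables).
§0 A6: `rStepW_of_liveSel_of_rstep` — (𝐑ʷ) HOLDS on the live-selector line (core provisos row `rstep`, selector clause, admissibility, `0 ≤ κ, E₀, B₀`): p591271 §1 bundled.
§1 LAW LEVEL: `rStepLaw_of_rStepW` ((𝐑ʷ) ⇒ `∀ k < K, TLaw_k → SLaw_{k+1}`) · ★ `rOpLeaf_of_rStepW` ((𝐑ʷ) ⇒ the p. 244 object of record) · `rAssumedP244_of_rStepW` ([III]'s own name).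
§2 THE CHAIN UNDER (𝐑ʷ), generic `θ` (`1 ≤ M`, `0 ≤ B₀` only; per level `k < K` and FOR THE CHAIN's level-`k` WITNESS ONLY, each allowed to assume that witness's §2 form: the supplier's
   response universal in 𝐄, (OE) `NewEClausesAt`, `PresentChildObligations` at the 𝐓-present expansion children, dag-n11-d's `NoExpansionClauseFor`): ★★★ `formAtZS_chainWitness_of_rStepW`
   (the chain witness HAS the §2 form of `ρ_k` at every `k ≤ K`) · `sLaw₁₃CoPH_all_of_chain_of_rStepW` (THEOREM 1 OF [III]) · `formT_chainWitness_succ_of_rStepW` (the chain's level-`(k+1)`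
   witness IS the 𝐓-image witness at `k`) · `tLaw₁₃CoPH_all_of_chain_of_rStepW` · `thmP245Laws_of_chain_of_rStepW` (the (S1ᵀ) slot `∀ k < K, SLaw_k → TLaw_k`) · node faces
   `densitiesDescribed_of_chain_of_rStepW_core` (PROVISO-FREE, any world C-bound to the core's construction) · `densitiesDescribed_of_chain_of_rStepW` · ★★ `b14_main_of_chain_of_rStepW`
   (N11's DAG node at a world C-bound to the CoPH datum: the 𝐑-antecedent is NOT READ — (𝐑ʷ) already gives the leaf; the other in-edges are not read either).
§3 THE ChainRows TWIN UNDER (𝐑ʷ) (dag-n11-d's ROWS at the no-expansion histories with a present parent instead of `NoExpansionClauseFor`; core provisos `h` and `ZhUnity` are the ROWS'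
   keys, not the 𝐑-side's): ★★★★ `formAtZS_chainWitness_of_rows_of_rStepW` · `sLaw₁₃CoPH_all_of_chain_of_rows_of_rStepW` · `tLaw₁₃CoPH_all_of_chain_of_rows_of_rStepW`.
§4 PER WINDOWED RUN: `thm1Printed_datumOfRecord₁₃CoPH_of_tLaw_all_of_rStepW` (`B16.Thm1Printed` at the CoPH datum from, per windowed run, the 𝐓-image laws at all levels — §2∕§3's output —
   and (𝐑ʷ)) · `thm1Printed_datumOfRecord₁₃SepCoPH_of_tLaw_all_of_rStepW` (K1⁷'s separated-range key).
NOT HERE: the record-door corollary with every generic side condition discharged (dag-n11-e g16's (t60), theirs).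

HONEST FRAMING.  Helper lane, count-neutral KERNEL BOOKKEEPING; (𝐑ʷ), the suppliers' obligations and dag-n11-d's clause ∕ rows are DISPLAYED HYPOTHESES, not proved; nothing of
Bałaban is asserted; N11 is NOT discharged; K1⁷ is NOT closed; counts unmoved (typed 28∕28 · discharged 5∕27).  One finite `𝕋⁴_{L^K}` programme at fixed `ε = L^{−K}`; R4 closes only
the conditional finite-𝕋⁴ rung `BalabanLadder.UV` — NOT ℝ⁴, NOT OS, NOT a mass gap, NOT Clay.  No `sorry`, no `axiom`, no `def`, no `instance`, no `notation`.
Sources: [III] Theorem p.245, p.244 L36–38, (0.2) p.244, Thm 1 p.262, Thm 2 p.263, §2 p.262, remark p.262, §3 pp.264–265, (3.20) p.269, (3.24)–(3.25) p.270, §3 p.279, (2.17)–(2.18)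
p.257, (2.23)–(2.31) pp.258–260, (2.34)–(2.42) p.261; [IV] (0.2)–(0.6) pp.176–177, p.177 (i)–(ii); [B16] Thm 1 p.355 (the assumption's source, not exercised).
-/

noncomputable section

open MeasureTheory
open scoped BigOperators ENNReal NNReal Matrix.Norms.L2Operator

namespace Summit.QuantumFields.YangMills.Theorems.BalabanUVNodesN11ThmP245OfSupplyChainRAssumedCoPH

open Literature.MathematicalPhysics.QuantumFieldTheory.Balaban1983to89 T4Continuum T4NestedCovariance Node00 Node00.Tk DagBinding
open B15DeterminingSets
open Literature.MathematicalPhysics.QuantumFieldTheory.Balaban1983to89.B16RLeafRecord13LiveCoPH (densitiesDescribed_leavesP_iff_sLaw₁₃CoPH_all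
  densitiesDescribed_at_record₁₃CoPH_of_laws b14_main_at_record₁₃CoPH_of_rOpLeaf)
open Literature.MathematicalPhysics.QuantumFieldTheory.Balaban1983to89.B14NodeKnitRecord13RCoPH (rOpLeaf₁₃CoPH_iff_rAssumedP244)
open BalabanUVNodesN11FluctTruncationDefs
open BalabanUVNodesN11Sect3SupplyChainDefs
open BalabanUVNodesN11Sect3SupplyChain (formAtZS_succ_of_formT_of_liveSel_of_rstep formT_spliceTermsB_of_rows)
open BalabanUVNodesN11Sect3SupplyChainRows (noExpansionClauseFor_of_form_of_local_of_rows)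

variable {F : T4Family} {N : ℕ} [NeZero N]
variable (θ : Stage13HParams F N) (p : B12.RunParams)

/-! ## §0. A6 — (𝐑ʷ) is inhabited where the tree says so: the live-selector line -/

section Instance

/-- **A6 — (𝐑ʷ) HOLDS ON THE LIVE-SELECTOR LINE**: under the core provisos (row `rstep` = def-R's (0.3) provisos of the pre-𝐑 tower), the selector clause, admissibility and the signs
`0 ≤ κ, E₀, B₀`, EVERY 𝐓-image witness at level `k < K` is a §2 witness of `ρ_{k+1}` with the same terms — dag-n11-e's p591271 §1 `formAtZS_succ_of_formT_of_liveSel_of_rstep`, bundled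
over `k` and the witness.  So the displayed hypothesis of §1–§4 is the tree's on that line. [cite: Balaban1988Convergent, §2 p.262, (3.24)–(3.25) p.270, p.244 L36–38; Balaban1989LargeFieldI, (0.2)–(0.4) p.176, p.177 (i)–(ii)] -/
theorem rStepW_of_liveSel_of_rstep (h : θ.Provisos₁₃CoPH F N)
    (hsel : θ.ppSel = ppSelLiveOfRecord F N θ.ν θ.τ9 (EOfRecord₁₃ F N θ.toStage13Params) (wOfRecord₉ F N θ.toStage9Params))
    (hθ : θ.Admissible F N) (hκ : 0 ≤ θ.s2.lf.κ) (hE₀ : 0 ≤ θ.s2.lf.E₀) (hB₀ : 0 ≤ θ.s2.lf.B₀) :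
    ∀ k, k < p.K → ∀ (tT : SeqOfRecord F θ.ν θ.τ9.M (gOfRecord₁₃ F N θ.toStage13Params p) p.K (k + 1) → Sect2.TermValues (F.P p.K) (MatA N) (FluctV N) θ.τ9.M)
      (EkT : SeqOfRecord F θ.ν θ.τ9.M (gOfRecord₁₃ F N θ.toStage13Params p) p.K (k + 1) → ℝ),
      HasSect2FormAtZS F N (FluctV N) p.K (settingOfRecord₁₃ F N θ.toStage13Params p) (k + 1) (θ.rzAt p) (WtOfRecord₁₃H F N θ p) (UbgOfRecord₁₃CoP F N θ.toStage13Params p (k + 1))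
        (fun s u => Sect2.LawsT (sect2TowerOfRecord F N (FluctV N) p.K (settingOfRecord₁₃ F N θ.toStage13Params p) (θ.rzAt p s) s u) (settingOfRecord₁₃ F N θ.toStage13Params p).lf (settingOfRecord₁₃ F N θ.toStage13Params p).βc k)
        (slotsTOfRecord F N θ.ν θ.τ9 (EOfRecord₁₃ F N θ.toStage13Params) (wOfRecord₉ F N θ.toStage9Params) θ.ppSel p (gOfRecord₁₃ F N θ.toStage13Params p) (k + 1)) tT EkT →
      HasSect2FormAtZS F N (FluctV N) p.K (settingOfRecord₁₃ F N θ.toStage13Params p) (k + 1) (θ.rzAt p) (WtOfRecord₁₃H F N θ p) (UbgOfRecord₁₃CoP F N θ.toStage13Params p (k + 1))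
        (fun s u => Sect2.LawsRT (sect2TowerOfRecord F N (FluctV N) p.K (settingOfRecord₁₃ F N θ.toStage13Params p) (θ.rzAt p s) s u) (settingOfRecord₁₃ F N θ.toStage13Params p).lf (k + 1))
        (slotsOfRecord F N θ.ν θ.τ9 (EOfRecord₁₃ F N θ.toStage13Params) (wOfRecord₉ F N θ.toStage9Params) θ.ppSel p (gOfRecord₁₃ F N θ.toStage13Params p) (k + 1)) tT EkT :=
  fun _ hk tT EkT hT => formAtZS_succ_of_formT_of_liveSel_of_rstep θ p h hsel hθ hκ hE₀ hB₀ hk tT EkT hT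

end Instance

/-! ## §1. Law level: (𝐑ʷ) implies the p. 244 object of record -/

section LawLevel

variable
  (hRw : ∀ k, k < p.K → ∀ (tT : SeqOfRecord F θ.ν θ.τ9.M (gOfRecord₁₃ F N θ.toStage13Params p) p.K (k + 1) → Sect2.TermValues (F.P p.K) (MatA N) (FluctV N) θ.τ9.M)
      (EkT : SeqOfRecord F θ.ν θ.τ9.M (gOfRecord₁₃ F N θ.toStage13Params p) p.K (k + 1) → ℝ),
      HasSect2FormAtZS F N (FluctV N) p.K (settingOfRecord₁₃ F N θ.toStage13Params p) (k + 1) (θ.rzAt p) (WtOfRecord₁₃H F N θ p) (UbgOfRecord₁₃CoP F N θ.toStage13Params p (k + 1))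
        (fun s u => Sect2.LawsT (sect2TowerOfRecord F N (FluctV N) p.K (settingOfRecord₁₃ F N θ.toStage13Params p) (θ.rzAt p s) s u) (settingOfRecord₁₃ F N θ.toStage13Params p).lf (settingOfRecord₁₃ F N θ.toStage13Params p).βc k)
        (slotsTOfRecord F N θ.ν θ.τ9 (EOfRecord₁₃ F N θ.toStage13Params) (wOfRecord₉ F N θ.toStage9Params) θ.ppSel p (gOfRecord₁₃ F N θ.toStage13Params p) (k + 1)) tT EkT →
      HasSect2FormAtZS F N (FluctV N) p.K (settingOfRecord₁₃ F N θ.toStage13Params p) (k + 1) (θ.rzAt p) (WtOfRecord₁₃H F N θ p) (UbgOfRecord₁₃CoP F N θ.toStage13Params p (k + 1))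
        (fun s u => Sect2.LawsRT (sect2TowerOfRecord F N (FluctV N) p.K (settingOfRecord₁₃ F N θ.toStage13Params p) (θ.rzAt p s) s u) (settingOfRecord₁₃ F N θ.toStage13Params p).lf (k + 1))
        (slotsOfRecord F N θ.ν θ.τ9 (EOfRecord₁₃ F N θ.toStage13Params) (wOfRecord₉ F N θ.toStage9Params) θ.ppSel p (gOfRecord₁₃ F N θ.toStage13Params p) (k + 1)) tT EkT)
include hRw

/-- **(𝐑ʷ) ⇒ THE LAW FORM `∀ k < K, TLaw₁₃CoPH θ p k → SLaw₁₃CoPH θ p (k+1)`** (unpack `TLaw`'s witness by `tLaw₁₃CoPH_iff`, apply (𝐑ʷ) to it, repack by `sLaw₁₃CoPH_iff`).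
[cite: Balaban1988Convergent, p.244 L36–38, remark p.262, (2.17)–(2.18) p.257] -/
theorem rStepLaw_of_rStepW : ∀ k, k < p.K → TLaw₁₃CoPH F N θ p k → SLaw₁₃CoPH F N θ p (k + 1) := fun k hk hT => by
  obtain ⟨tT, EkT, hf⟩ := (tLaw₁₃CoPH_iff F N θ p k).mp hT
  exact (sLaw₁₃CoPH_iff F N θ p (k + 1)).mpr ⟨tT, EkT, hRw k hk tT EkT hf⟩

/-- **★ (𝐑ʷ) ⇒ [III]'s p. 244 OBJECT OF RECORD `ROpLeaf (VOfRecord₁₃CoPH θ p)`** (def-T's `rOpLeaf_VOfRecord₁₃CoPH_iff`).  The converse does NOT hold in general (the leaf gives SOME §2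
witness of `ρ_{k+1}`, (𝐑ʷ) names it) and is not claimed. [cite: Balaban1988Convergent, p.244 L36–38, remark p.262; Balaban1989LargeFieldI, (0.2)–(0.3) p.176] -/
theorem rOpLeaf_of_rStepW : ROpLeaf (VOfRecord₁₃CoPH F N θ p) :=
  (rOpLeaf_VOfRecord₁₃CoPH_iff F N θ p).mpr (rStepLaw_of_rStepW θ p hRw)

/-- **(𝐑ʷ) ⇒ [III]'s p. 244 SENTENCE IN ITS OWN NAME** — `B14.RAssumedP244` at the 𝐑-carriers of record (`Iff.rfl` with the leaf, `rOpLeaf₁₃CoPH_iff_rAssumedP244`).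
[cite: Balaban1988Convergent, p.244 L36–38, Thm 1 p.262] -/
theorem rAssumedP244_of_rStepW : B14.RAssumedP244 (VOfRecord₁₃CoPH F N θ p).R (VOfRecord₁₃CoPH F N θ p).Scorr (VOfRecord₁₃CoPH F N θ p).S p.K :=
  (rOpLeaf₁₃CoPH_iff_rAssumedP244 F N θ p).mp (rOpLeaf_of_rStepW θ p hRw)

end LawLevel

/-! ## §2. Theorem 1 along the witness chain under (𝐑ʷ), generic `θ`; the (S1ᵀ) slot; the node faces -/

section Chain

variable (σ : Sect3Supplier θ p)
  (huN : ∀ k, k < p.K → HasSect2FormAtZS F N (FluctV N) p.K (settingOfRecord₁₃ F N θ.toStage13Params p) k (θ.rzAt p) (WtOfRecord₁₃H F N θ p) (UbgOfRecord₁₃CoP F N θ.toStage13Params p k)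
      (fun s u => Sect2.LawsRT (sect2TowerOfRecord F N (FluctV N) p.K (settingOfRecord₁₃ F N θ.toStage13Params p) (θ.rzAt p s) s u) (settingOfRecord₁₃ F N θ.toStage13Params p).lf k)
      (slotsOfRecord F N θ.ν θ.τ9 (EOfRecord₁₃ F N θ.toStage13Params) (wOfRecord₉ F N θ.toStage9Params) θ.ppSel p (gOfRecord₁₃ F N θ.toStage13Params p) k) (chainWitness θ p σ k).1 (chainWitness θ p σ k).2 →
    Sect2.UniversalE (σ k (chainWitness θ p σ k).1 (chainWitness θ p σ k).2).1)
  (hOE : ∀ k, k < p.K → HasSect2FormAtZS F N (FluctV N) p.K (settingOfRecord₁₃ F N θ.toStage13Params p) k (θ.rzAt p) (WtOfRecord₁₃H F N θ p) (UbgOfRecord₁₃CoP F N θ.toStage13Params p k)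
      (fun s u => Sect2.LawsRT (sect2TowerOfRecord F N (FluctV N) p.K (settingOfRecord₁₃ F N θ.toStage13Params p) (θ.rzAt p s) s u) (settingOfRecord₁₃ F N θ.toStage13Params p).lf k)
      (slotsOfRecord F N θ.ν θ.τ9 (EOfRecord₁₃ F N θ.toStage13Params) (wOfRecord₉ F N θ.toStage9Params) θ.ppSel p (gOfRecord₁₃ F N θ.toStage13Params p) k) (chainWitness θ p σ k).1 (chainWitness θ p σ k).2 →
    ∀ s : SeqOfRecord F θ.ν θ.τ9.M (gOfRecord₁₃ F N θ.toStage13Params p) p.K (k + 1), NewEClausesAt θ p k ((σ k (chainWitness θ p σ k).1 (chainWitness θ p σ k).2).1 s) s)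
  (hpres : ∀ k, k < p.K → HasSect2FormAtZS F N (FluctV N) p.K (settingOfRecord₁₃ F N θ.toStage13Params p) k (θ.rzAt p) (WtOfRecord₁₃H F N θ p) (UbgOfRecord₁₃CoP F N θ.toStage13Params p k)
      (fun s u => Sect2.LawsRT (sect2TowerOfRecord F N (FluctV N) p.K (settingOfRecord₁₃ F N θ.toStage13Params p) (θ.rzAt p s) s u) (settingOfRecord₁₃ F N θ.toStage13Params p).lf k)
      (slotsOfRecord F N θ.ν θ.τ9 (EOfRecord₁₃ F N θ.toStage13Params) (wOfRecord₉ F N θ.toStage9Params) θ.ppSel p (gOfRecord₁₃ F N θ.toStage13Params p) k) (chainWitness θ p σ k).1 (chainWitness θ p σ k).2 →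
    ∀ s : SeqOfRecord F θ.ν θ.τ9.M (gOfRecord₁₃ F N θ.toStage13Params p) p.K (k + 1), s.Ω (k + 1) ≠ ∅ →
      slotsTOfRecord F N θ.ν θ.τ9 (EOfRecord₁₃ F N θ.toStage13Params) (wOfRecord₉ F N θ.toStage9Params) θ.ppSel p (gOfRecord₁₃ F N θ.toStage13Params p) (k + 1) s ≠ 0 →
      PresentChildObligations θ p k (chainWitness θ p σ k).1 (σ k (chainWitness θ p σ k).1 (chainWitness θ p σ k).2).1 (σ k (chainWitness θ p σ k).1 (chainWitness θ p σ k).2).2 s)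
  (hTcl : ∀ k, k < p.K → HasSect2FormAtZS F N (FluctV N) p.K (settingOfRecord₁₃ F N θ.toStage13Params p) k (θ.rzAt p) (WtOfRecord₁₃H F N θ p) (UbgOfRecord₁₃CoP F N θ.toStage13Params p k)
      (fun s u => Sect2.LawsRT (sect2TowerOfRecord F N (FluctV N) p.K (settingOfRecord₁₃ F N θ.toStage13Params p) (θ.rzAt p s) s u) (settingOfRecord₁₃ F N θ.toStage13Params p).lf k)
      (slotsOfRecord F N θ.ν θ.τ9 (EOfRecord₁₃ F N θ.toStage13Params) (wOfRecord₉ F N θ.toStage9Params) θ.ppSel p (gOfRecord₁₃ F N θ.toStage13Params p) k) (chainWitness θ p σ k).1 (chainWitness θ p σ k).2 →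
    NoExpansionClauseFor θ p k (chainWitness θ p σ k).1 (chainWitness θ p σ k).2)
  (hRw : ∀ k, k < p.K → ∀ (tT : SeqOfRecord F θ.ν θ.τ9.M (gOfRecord₁₃ F N θ.toStage13Params p) p.K (k + 1) → Sect2.TermValues (F.P p.K) (MatA N) (FluctV N) θ.τ9.M)
      (EkT : SeqOfRecord F θ.ν θ.τ9.M (gOfRecord₁₃ F N θ.toStage13Params p) p.K (k + 1) → ℝ),
      HasSect2FormAtZS F N (FluctV N) p.K (settingOfRecord₁₃ F N θ.toStage13Params p) (k + 1) (θ.rzAt p) (WtOfRecord₁₃H F N θ p) (UbgOfRecord₁₃CoP F N θ.toStage13Params p (k + 1))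
        (fun s u => Sect2.LawsT (sect2TowerOfRecord F N (FluctV N) p.K (settingOfRecord₁₃ F N θ.toStage13Params p) (θ.rzAt p s) s u) (settingOfRecord₁₃ F N θ.toStage13Params p).lf (settingOfRecord₁₃ F N θ.toStage13Params p).βc k)
        (slotsTOfRecord F N θ.ν θ.τ9 (EOfRecord₁₃ F N θ.toStage13Params) (wOfRecord₉ F N θ.toStage9Params) θ.ppSel p (gOfRecord₁₃ F N θ.toStage13Params p) (k + 1)) tT EkT →
      HasSect2FormAtZS F N (FluctV N) p.K (settingOfRecord₁₃ F N θ.toStage13Params p) (k + 1) (θ.rzAt p) (WtOfRecord₁₃H F N θ p) (UbgOfRecord₁₃CoP F N θ.toStage13Params p (k + 1))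
        (fun s u => Sect2.LawsRT (sect2TowerOfRecord F N (FluctV N) p.K (settingOfRecord₁₃ F N θ.toStage13Params p) (θ.rzAt p s) s u) (settingOfRecord₁₃ F N θ.toStage13Params p).lf (k + 1))
        (slotsOfRecord F N θ.ν θ.τ9 (EOfRecord₁₃ F N θ.toStage13Params) (wOfRecord₉ F N θ.toStage9Params) θ.ppSel p (gOfRecord₁₃ F N θ.toStage13Params p) (k + 1)) tT EkT)
include huN hOE hpres hTcl hRw

/-- **★★★ THE CHAIN WITNESS HAS THE §2 FORM OF `ρ_k` AT EVERY LEVEL `k ≤ K`, UNDER (𝐑ʷ), GENERIC `θ`** — dag-n11-e's `formAtZS_chainWitness` with its live-line 𝐑-step replaced by the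
displayed witness-level hypothesis (𝐑ʷ): induction on `k`, base def-T's level-0 witness (`baseWitness_form`), step = the witness-level 𝐓-step `formT_spliceTermsB_of_rows` (the splice of
the chain's level-`k` witness with the supplier's response IS a 𝐓-image witness at `k`, from (OE), `PresentChildObligations`, `NoExpansionClauseFor` — each FOR THE CHAIN's WITNESS and allowed
to assume its §2 form) followed by (𝐑ʷ) at that witness.  `1 ≤ M`, `0 ≤ B₀`; NO selector clause, NO admissibility, NO `κ ∕ E₀` sign, NO `Provisos₁₃CoPH`.
[cite: Balaban1988Convergent, Thm 1 p.262, Theorem p.245, Thm 2 p.263, §3 p.279, (3.24)–(3.25) p.270, p.244 L36–38] -/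
theorem formAtZS_chainWitness_of_rStepW (hM : 1 ≤ θ.τ9.M) (hB₀ : 0 ≤ θ.s2.lf.B₀) :
    ∀ k, k ≤ p.K → HasSect2FormAtZS F N (FluctV N) p.K (settingOfRecord₁₃ F N θ.toStage13Params p) k (θ.rzAt p) (WtOfRecord₁₃H F N θ p) (UbgOfRecord₁₃CoP F N θ.toStage13Params p k)
      (fun s u => Sect2.LawsRT (sect2TowerOfRecord F N (FluctV N) p.K (settingOfRecord₁₃ F N θ.toStage13Params p) (θ.rzAt p s) s u) (settingOfRecord₁₃ F N θ.toStage13Params p).lf k)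
      (slotsOfRecord F N θ.ν θ.τ9 (EOfRecord₁₃ F N θ.toStage13Params) (wOfRecord₉ F N θ.toStage9Params) θ.ppSel p (gOfRecord₁₃ F N θ.toStage13Params p) k) (chainWitness θ p σ k).1 (chainWitness θ p σ k).2 := by
  intro k
  induction k with
  | zero => exact fun _ => baseWitness_form θ p
  | succ k ih =>
    intro hk
    have hk' : k < p.K := Nat.lt_of_succ_le hk
    exact hRw k hk' _ _
      (formT_spliceTermsB_of_rows θ p hM hB₀ _ _ (ih hk'.le) _ _ (huN k hk' (ih hk'.le)) (hOE k hk' (ih hk'.le)) (hpres k hk' (ih hk'.le)) (hTcl k hk' (ih hk'.le)))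

/-- **★★★ THEOREM 1 OF [III] AT `θ`, ALL LEVELS, ALL HISTORIES — `∀ k ≤ K, SLaw₁₃CoPH θ p k` — FROM THE WITNESS-KEYED SUPPLY CHAIN AND (𝐑ʷ), GENERIC `θ`** (the hand-out's name: the
(𝐑ʷ)-keyed twin of p591271 `sLaw₁₃CoPH_all_of_chain`). [cite: Balaban1988Convergent, Thm 1 p.262, Theorem p.245, p.244 L36–38; Balaban1989LargeFieldI, (0.2)–(0.4) p.176] -/
theorem sLaw₁₃CoPH_all_of_chain_of_rStepW (hM : 1 ≤ θ.τ9.M) (hB₀ : 0 ≤ θ.s2.lf.B₀) : ∀ k, k ≤ p.K → SLaw₁₃CoPH F N θ p k := fun k hk =>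
  (sLaw₁₃CoPH_iff F N θ p k).mpr ⟨_, _, formAtZS_chainWitness_of_rStepW θ p σ huN hOE hpres hTcl hRw hM hB₀ k hk⟩

/-- **THE CHAIN's LEVEL-`(k+1)` WITNESS IS THE 𝐓-IMAGE WITNESS AT LEVEL `k`** (`k < K`): the splice `(spliceTermsB …, spliceConst …)` of the chain's level-`k` witness with the supplier's
response has the laws `Sect2.LawsT … k` and the 𝐓-image clause at every history of length `k+1` — `formT_spliceTermsB_of_rows` at the chain's §2 form (§2's first theorem at `k`).
[cite: Balaban1988Convergent, §2 p.262, §3 p.279, (3.24)–(3.25) p.270, Theorem p.245] -/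
theorem formT_chainWitness_succ_of_rStepW (hM : 1 ≤ θ.τ9.M) (hB₀ : 0 ≤ θ.s2.lf.B₀) {k : ℕ} (hk : k < p.K) :
    HasSect2FormAtZS F N (FluctV N) p.K (settingOfRecord₁₃ F N θ.toStage13Params p) (k + 1) (θ.rzAt p) (WtOfRecord₁₃H F N θ p) (UbgOfRecord₁₃CoP F N θ.toStage13Params p (k + 1))
      (fun s u => Sect2.LawsT (sect2TowerOfRecord F N (FluctV N) p.K (settingOfRecord₁₃ F N θ.toStage13Params p) (θ.rzAt p s) s u) (settingOfRecord₁₃ F N θ.toStage13Params p).lf (settingOfRecord₁₃ F N θ.toStage13Params p).βc k)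
      (slotsTOfRecord F N θ.ν θ.τ9 (EOfRecord₁₃ F N θ.toStage13Params) (wOfRecord₉ F N θ.toStage9Params) θ.ppSel p (gOfRecord₁₃ F N θ.toStage13Params p) (k + 1))
      (chainWitness θ p σ (k + 1)).1 (chainWitness θ p σ (k + 1)).2 :=
  formT_spliceTermsB_of_rows θ p hM hB₀ _ _ (formAtZS_chainWitness_of_rStepW θ p σ huN hOE hpres hTcl hRw hM hB₀ k hk.le) _ _
    (huN k hk (formAtZS_chainWitness_of_rStepW θ p σ huN hOE hpres hTcl hRw hM hB₀ k hk.le))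
    (hOE k hk (formAtZS_chainWitness_of_rStepW θ p σ huN hOE hpres hTcl hRw hM hB₀ k hk.le))
    (hpres k hk (formAtZS_chainWitness_of_rStepW θ p σ huN hOE hpres hTcl hRw hM hB₀ k hk.le))
    (hTcl k hk (formAtZS_chainWitness_of_rStepW θ p σ huN hOE hpres hTcl hRw hM hB₀ k hk.le))

/-- **… HENCE THE 𝐓-IMAGE LAWS `TLaw₁₃CoPH θ p k` AT EVERY `k < K`** (def-T's `tLaw₁₃CoPH_iff` at the chain's 𝐓-image witness). [cite: Balaban1988Convergent, Theorem p.245, remark p.262, §3 p.279] -/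
theorem tLaw₁₃CoPH_all_of_chain_of_rStepW (hM : 1 ≤ θ.τ9.M) (hB₀ : 0 ≤ θ.s2.lf.B₀) : ∀ k, k < p.K → TLaw₁₃CoPH F N θ p k := fun k hk =>
  (tLaw₁₃CoPH_iff F N θ p k).mpr ⟨_, _, formT_chainWitness_succ_of_rStepW θ p σ huN hOE hpres hTcl hRw hM hB₀ hk⟩

/-- **THE (S1ᵀ) SLOT OF N11's ROW — `∀ k < K, SLaw₁₃CoPH θ p k → TLaw₁₃CoPH θ p k` — along the chain under (𝐑ʷ)** (the conclusion holds outright at every level; the shape is the one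
the node faces consume). [cite: Balaban1988Convergent, Theorem p.245, Thm 1 p.262] -/
theorem thmP245Laws_of_chain_of_rStepW (hM : 1 ≤ θ.τ9.M) (hB₀ : 0 ≤ θ.s2.lf.B₀) : ∀ k, k < p.K → SLaw₁₃CoPH F N θ p k → TLaw₁₃CoPH F N θ p k :=
  fun k hk _ => tLaw₁₃CoPH_all_of_chain_of_rStepW θ p σ huN hOE hpres hTcl hRw hM hB₀ k hk

/-- **★ N11's NODE SENTENCE `densitiesDescribed` — PROVISO-FREE — at ANY world whose C-binding is the CoPH core's construction over the densities of record**, along the chain under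
(𝐑ʷ) (p540794 `densitiesDescribed_leavesP_iff_sLaw₁₃CoPH_all`).  Generic `θ`. [cite: Balaban1988Convergent, Thm 1 p.262, Theorem p.245, p.244 L36–38] -/
theorem densitiesDescribed_of_chain_of_rStepW_core (hM : 1 ≤ θ.τ9.M) (hB₀ : 0 ≤ θ.s2.lf.B₀)
    (w : WorldP) (hC : w.C = (coreOfRecord₁₃CoPH F N θ).construction (densOfRecord₁₃ F N θ.toStage13Params)) :
    (leavesP w p).densitiesDescribed :=
  (densitiesDescribed_leavesP_iff_sLaw₁₃CoPH_all F N θ p w hC).2 (sLaw₁₃CoPH_all_of_chain_of_rStepW θ p σ huN hOE hpres hTcl hRw hM hB₀)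

/-- **N11's NODE SENTENCE `densitiesDescribed` AT A WORLD BOUND TO THE CoPH DATUM OF `θ`** (`w.C = (datumOfRecord₁₃CoPH θ h).C`; `h` is only the datum's key), along the chain under (𝐑ʷ)
(p540794 `densitiesDescribed_at_record₁₃CoPH_of_laws` with the law form of §1). [cite: Balaban1988Convergent, Thm 1 p.262, Theorem p.245, p.244 L36–38] -/
theorem densitiesDescribed_of_chain_of_rStepW (h : θ.Provisos₁₃CoPH F N) (hM : 1 ≤ θ.τ9.M) (hB₀ : 0 ≤ θ.s2.lf.B₀)
    (w : WorldP) (hC : w.C = (datumOfRecord₁₃CoPH F N θ h).C) : (leavesP w p).densitiesDescribed :=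
  densitiesDescribed_at_record₁₃CoPH_of_laws F N θ p w h hC (rStepLaw_of_rStepW θ p hRw) (thmP245Laws_of_chain_of_rStepW θ p σ huN hOE hpres hTcl hRw hM hB₀)

/-- **★★ N11's DAG NODE `Dag.B14_main (leavesP w p)` AT A WORLD C-BOUND TO THE CoPH DATUM, ALONG THE CHAIN UNDER (𝐑ʷ)**: the node's own 𝐑-antecedent `(leavesP w p).rOperation` is NOT
READ ((𝐑ʷ) already gives the leaf, §1), nor are the other in-edges `b7 … b11`, `smallCouplings`, `smallFieldInductive`, `flowControl` (p540794 `b14_main_at_record₁₃CoPH_of_rOpLeaf`).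
[cite: Balaban1988Convergent, Thm 1 p.262, Theorem p.245, p.244 L36–38; Balaban1989LargeFieldII, Thm 1 p.355 (the in-edge's source, not exercised)] -/
theorem b14_main_of_chain_of_rStepW (h : θ.Provisos₁₃CoPH F N) (hM : 1 ≤ θ.τ9.M) (hB₀ : 0 ≤ θ.s2.lf.B₀)
    (w : WorldP) (hC : w.C = (datumOfRecord₁₃CoPH F N θ h).C) : Dag.B14_main (leavesP w p) :=
  b14_main_at_record₁₃CoPH_of_rOpLeaf F N θ p w h hC (fun _ => rOpLeaf_of_rStepW θ p hRw)
    (fun _ _ _ _ _ _ _ _ => thmP245Laws_of_chain_of_rStepW θ p σ huN hOE hpres hTcl hRw hM hB₀)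

end Chain

/-! ## §3. The ChainRows twin under (𝐑ʷ): dag-n11-d's ROWS in place of `NoExpansionClauseFor` -/

section Rows

variable (σ : Sect3Supplier θ p)
  (hσloc : ∀ k (s : SeqOfRecord F θ.ν θ.τ9.M (gOfRecord₁₃ F N θ.toStage13Params p) p.K (k + 1)), IsFluctLocal (k + 1) ((σ k (chainWitness θ p σ k).1 (chainWitness θ p σ k).2).1 s))
  (huN : ∀ k, k < p.K → HasSect2FormAtZS F N (FluctV N) p.K (settingOfRecord₁₃ F N θ.toStage13Params p) k (θ.rzAt p) (WtOfRecord₁₃H F N θ p) (UbgOfRecord₁₃CoP F N θ.toStage13Params p k)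
      (fun s u => Sect2.LawsRT (sect2TowerOfRecord F N (FluctV N) p.K (settingOfRecord₁₃ F N θ.toStage13Params p) (θ.rzAt p s) s u) (settingOfRecord₁₃ F N θ.toStage13Params p).lf k)
      (slotsOfRecord F N θ.ν θ.τ9 (EOfRecord₁₃ F N θ.toStage13Params) (wOfRecord₉ F N θ.toStage9Params) θ.ppSel p (gOfRecord₁₃ F N θ.toStage13Params p) k) (chainWitness θ p σ k).1 (chainWitness θ p σ k).2 →
    Sect2.UniversalE (σ k (chainWitness θ p σ k).1 (chainWitness θ p σ k).2).1)
  (hOE : ∀ k, k < p.K → HasSect2FormAtZS F N (FluctV N) p.K (settingOfRecord₁₃ F N θ.toStage13Params p) k (θ.rzAt p) (WtOfRecord₁₃H F N θ p) (UbgOfRecord₁₃CoP F N θ.toStage13Params p k)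
      (fun s u => Sect2.LawsRT (sect2TowerOfRecord F N (FluctV N) p.K (settingOfRecord₁₃ F N θ.toStage13Params p) (θ.rzAt p s) s u) (settingOfRecord₁₃ F N θ.toStage13Params p).lf k)
      (slotsOfRecord F N θ.ν θ.τ9 (EOfRecord₁₃ F N θ.toStage13Params) (wOfRecord₉ F N θ.toStage9Params) θ.ppSel p (gOfRecord₁₃ F N θ.toStage13Params p) k) (chainWitness θ p σ k).1 (chainWitness θ p σ k).2 →
    ∀ s : SeqOfRecord F θ.ν θ.τ9.M (gOfRecord₁₃ F N θ.toStage13Params p) p.K (k + 1), NewEClausesAt θ p k ((σ k (chainWitness θ p σ k).1 (chainWitness θ p σ k).2).1 s) s)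
  (hpres : ∀ k, k < p.K → HasSect2FormAtZS F N (FluctV N) p.K (settingOfRecord₁₃ F N θ.toStage13Params p) k (θ.rzAt p) (WtOfRecord₁₃H F N θ p) (UbgOfRecord₁₃CoP F N θ.toStage13Params p k)
      (fun s u => Sect2.LawsRT (sect2TowerOfRecord F N (FluctV N) p.K (settingOfRecord₁₃ F N θ.toStage13Params p) (θ.rzAt p s) s u) (settingOfRecord₁₃ F N θ.toStage13Params p).lf k)
      (slotsOfRecord F N θ.ν θ.τ9 (EOfRecord₁₃ F N θ.toStage13Params) (wOfRecord₉ F N θ.toStage9Params) θ.ppSel p (gOfRecord₁₃ F N θ.toStage13Params p) k) (chainWitness θ p σ k).1 (chainWitness θ p σ k).2 →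
    ∀ s : SeqOfRecord F θ.ν θ.τ9.M (gOfRecord₁₃ F N θ.toStage13Params p) p.K (k + 1), s.Ω (k + 1) ≠ ∅ →
      slotsTOfRecord F N θ.ν θ.τ9 (EOfRecord₁₃ F N θ.toStage13Params) (wOfRecord₉ F N θ.toStage9Params) θ.ppSel p (gOfRecord₁₃ F N θ.toStage13Params p) (k + 1) s ≠ 0 →
      PresentChildObligations θ p k (chainWitness θ p σ k).1 (σ k (chainWitness θ p σ k).1 (chainWitness θ p σ k).2).1 (σ k (chainWitness θ p σ k).1 (chainWitness θ p σ k).2).2 s)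
  (hrows : ∀ k, k < p.K → HasSect2FormAtZS F N (FluctV N) p.K (settingOfRecord₁₃ F N θ.toStage13Params p) k (θ.rzAt p) (WtOfRecord₁₃H F N θ p) (UbgOfRecord₁₃CoP F N θ.toStage13Params p k)
      (fun s u => Sect2.LawsRT (sect2TowerOfRecord F N (FluctV N) p.K (settingOfRecord₁₃ F N θ.toStage13Params p) (θ.rzAt p s) s u) (settingOfRecord₁₃ F N θ.toStage13Params p).lf k)
      (slotsOfRecord F N θ.ν θ.τ9 (EOfRecord₁₃ F N θ.toStage13Params) (wOfRecord₉ F N θ.toStage9Params) θ.ppSel p (gOfRecord₁₃ F N θ.toStage13Params p) k) (chainWitness θ p σ k).1 (chainWitness θ p σ k).2 →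
    ∀ s : SeqOfRecord F θ.ν θ.τ9.M (gOfRecord₁₃ F N θ.toStage13Params p) p.K (k + 1), s.Ω (k + 1) = ∅ →
      slotsOfRecord F N θ.ν θ.τ9 (EOfRecord₁₃ F N θ.toStage13Params) (wOfRecord₉ F N θ.toStage9Params) θ.ppSel p (gOfRecord₁₃ F N θ.toStage13Params p) k s.init ≠ 0 →
      (∀ j, j < k → (θ.zhAt p s).ζ0 j = (θ.zhAt p s.init).ζ0 j ∧ (θ.zhAt p s).quad j = (θ.zhAt p s.init).quad j) ∧
      (∀ (V' : GaugeField (F.P p.K) (k + 1) (SU N)) (U₀ : GaugeField (F.P p.K) k (SU N)),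
        (θ.zhAt p s).ζ0 k Set.univ (pairCfgAt (V := FluctV N) k V' U₀) =
          chiSeqOfRecord F N θ.ν θ.τ9.M (gOfRecord₁₃ F N θ.toStage13Params p) p.K k s.init U₀ *
            wOfRecord₉ F N θ.toStage9Params p (gOfRecord₁₃ F N θ.toStage13Params p) k s U₀ ((avOfRecord F N p.K k).avg U₀)) ∧
      (∀ (V' : GaugeField (F.P p.K) (k + 1) (SU N)) (U₀ : GaugeField (F.P p.K) k (SU N)), (θ.zhAt p s).quad k ∅ (pairCfgAt (V := FluctV N) k V' U₀) = 0) ∧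
      (∀ j, j < k → ∀ ω ω' : MultiCfg (F.P p.K) (SU N) (FluctV N), (∀ i, i ≤ k → ω i = ω' i) →
        (θ.zhAt p s).quad j (s.init.Λ (j + 1)) ω = (θ.zhAt p s).quad j (s.init.Λ (j + 1)) ω') ∧
      (∀ j (Y : Set (Site (F.P p.K) 0)), Measurable ((θ.zhAt p s).ζ0 j Y)) ∧
      (∀ j (Λ' : Set (Site (F.P p.K) 0)), Measurable ((θ.zhAt p s).quad j Λ')) ∧
      (∀ S ∈ admSOfRecord F θ.ν θ.τ9.M (gOfRecord₁₃ F N θ.toStage13Params p) p.K k s.init, ∀ j : ℕ,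
        ∃ ŵ : (↥(Set.toFinite (B10Eq42TorusConstraint.bondsIn j ((s.init.Λ (j + 1))ᶜ ∩ s.init.Ω (j + 1)))).toFinset → FluctV N) → ℝ≥0∞, Measurable ŵ ∧
          (∫⁻ a, ŵ a ∂(Measure.pi fun _ : ↥(Set.toFinite (B10Eq42TorusConstraint.bondsIn j ((s.init.Λ (j + 1))ᶜ ∩ s.init.Ω (j + 1)))).toFinset => (volume : Measure (FluctV N)))) ≠ ⊤ ∧
          ∀ ω, ENNReal.ofReal ((WtOfRecord₁₃H F N θ p s).w j (s.init.Λ (j + 1)) ((s.init.Λ (j + 1))ᶜ ∩ s.init.Ω (j + 1)) (S (j + 1)) ω) ≤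
            ŵ (fun b : ↥(Set.toFinite (B10Eq42TorusConstraint.bondsIn j ((s.init.Λ (j + 1))ᶜ ∩ s.init.Ω (j + 1)))).toFinset => (ω j).2 b)) ∧
      (∀ S ∈ admSOfRecord F θ.ν θ.τ9.M (gOfRecord₁₃ F N θ.toStage13Params p) p.K k s.init,
        Measurable (fun ω : MultiCfg (F.P p.K) (SU N) (FluctV N) =>
          sect2Operand F N (FluctV N) p.K (settingOfRecord₁₃ F N θ.toStage13Params p) (θ.rzAt p s.init) s.init ((chainWitness θ p σ k).1 s.init) ((chainWitness θ p σ k).2 s.init)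
              (UbgOfRecord₁₃CoP F N θ.toStage13Params p k s.init) (S, fun j => (ω j).2) (fun j => (ω j).1)) ∧
        ∃ CΦ : ℝ, ∀ a U, sect2Operand F N (FluctV N) p.K (settingOfRecord₁₃ F N θ.toStage13Params p) (θ.rzAt p s.init) s.init ((chainWitness θ p σ k).1 s.init) ((chainWitness θ p σ k).2 s.init)
              (UbgOfRecord₁₃CoP F N θ.toStage13Params p k s.init) a U ≤ CΦ))
  (hRw : ∀ k, k < p.K → ∀ (tT : SeqOfRecord F θ.ν θ.τ9.M (gOfRecord₁₃ F N θ.toStage13Params p) p.K (k + 1) → Sect2.TermValues (F.P p.K) (MatA N) (FluctV N) θ.τ9.M)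
      (EkT : SeqOfRecord F θ.ν θ.τ9.M (gOfRecord₁₃ F N θ.toStage13Params p) p.K (k + 1) → ℝ),
      HasSect2FormAtZS F N (FluctV N) p.K (settingOfRecord₁₃ F N θ.toStage13Params p) (k + 1) (θ.rzAt p) (WtOfRecord₁₃H F N θ p) (UbgOfRecord₁₃CoP F N θ.toStage13Params p (k + 1))
        (fun s u => Sect2.LawsT (sect2TowerOfRecord F N (FluctV N) p.K (settingOfRecord₁₃ F N θ.toStage13Params p) (θ.rzAt p s) s u) (settingOfRecord₁₃ F N θ.toStage13Params p).lf (settingOfRecord₁₃ F N θ.toStage13Params p).βc k)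
        (slotsTOfRecord F N θ.ν θ.τ9 (EOfRecord₁₃ F N θ.toStage13Params) (wOfRecord₉ F N θ.toStage9Params) θ.ppSel p (gOfRecord₁₃ F N θ.toStage13Params p) (k + 1)) tT EkT →
      HasSect2FormAtZS F N (FluctV N) p.K (settingOfRecord₁₃ F N θ.toStage13Params p) (k + 1) (θ.rzAt p) (WtOfRecord₁₃H F N θ p) (UbgOfRecord₁₃CoP F N θ.toStage13Params p (k + 1))
        (fun s u => Sect2.LawsRT (sect2TowerOfRecord F N (FluctV N) p.K (settingOfRecord₁₃ F N θ.toStage13Params p) (θ.rzAt p s) s u) (settingOfRecord₁₃ F N θ.toStage13Params p).lf (k + 1))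
        (slotsOfRecord F N θ.ν θ.τ9 (EOfRecord₁₃ F N θ.toStage13Params) (wOfRecord₉ F N θ.toStage9Params) θ.ppSel p (gOfRecord₁₃ F N θ.toStage13Params p) (k + 1)) tT EkT)
include hσloc huN hOE hpres hrows hRw

/-- **★★★★ THE CHAIN WITNESS HAS THE §2 FORM OF `ρ_k` AT EVERY `k ≤ K`, FROM THE SUPPLIERS' OBLIGATIONS + dag-n11-d's ROWS + (𝐑ʷ), GENERIC `θ`** — the (𝐑ʷ)-keyed twin of p592483's
chain: per level `k < K` and FOR THE CHAIN's `k`-LOCAL WITNESS, the supplier's response universal in 𝐄 and `(k+1)`-local, (OE), `PresentChildObligations`, and dag-n11-d's ROWS (the four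
pins of the general step, measurability of the residual, K0b's A-fibre domination, def-T ∕ def-R's operand rows) at the no-expansion histories with a present parent
(`noExpansionClauseFor_of_form_of_local_of_rows` inside §2).  Core provisos `h` and `ZhUnity` are the ROWS' keys (integrability of the old branches), not the 𝐑-side's: NO selector clause,
NO admissibility, NO `κ ∕ E₀` sign. [cite: Balaban1988Convergent, Thm 1 p.262, Theorem p.245, Thm 2 p.263, §3 p.279, (3.24)–(3.25) p.270, (3.16)–(3.21) pp.268–269, p.244 L36–38; Balaban1989LargeFieldI, (0.2)–(0.3) p.176] -/
theorem formAtZS_chainWitness_of_rows_of_rStepW (h : θ.Provisos₁₃CoPH F N) (hU : θ.ZhUnity F N) (hM : 1 ≤ θ.τ9.M) (hB₀ : 0 ≤ θ.s2.lf.B₀) :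
    ∀ k, k ≤ p.K → HasSect2FormAtZS F N (FluctV N) p.K (settingOfRecord₁₃ F N θ.toStage13Params p) k (θ.rzAt p) (WtOfRecord₁₃H F N θ p) (UbgOfRecord₁₃CoP F N θ.toStage13Params p k)
      (fun s u => Sect2.LawsRT (sect2TowerOfRecord F N (FluctV N) p.K (settingOfRecord₁₃ F N θ.toStage13Params p) (θ.rzAt p s) s u) (settingOfRecord₁₃ F N θ.toStage13Params p).lf k)
      (slotsOfRecord F N θ.ν θ.τ9 (EOfRecord₁₃ F N θ.toStage13Params) (wOfRecord₉ F N θ.toStage9Params) θ.ppSel p (gOfRecord₁₃ F N θ.toStage13Params p) k) (chainWitness θ p σ k).1 (chainWitness θ p σ k).2 :=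
  formAtZS_chainWitness_of_rStepW θ p σ huN hOE hpres
    (fun k' hk' hform => noExpansionClauseFor_of_form_of_local_of_rows θ p h hU hk' hM _ _ hform (fun s₀ => isFluctLocal_chainWitness θ p σ hσloc k' s₀) (hrows k' hk' hform))
    hRw hM hB₀

/-- **★★★★ THEOREM 1 OF [III] AT `θ`, ALL LEVELS — `∀ k ≤ K, SLaw₁₃CoPH θ p k` — FROM THE SUPPLIERS' OBLIGATIONS + dag-n11-d's ROWS + (𝐑ʷ), GENERIC `θ`** (the hand-out's name: the
(𝐑ʷ)-keyed twin of p592483 `sLaw₁₃CoPH_all_of_chain_of_rows`). [cite: Balaban1988Convergent, Thm 1 p.262, Theorem p.245, p.244 L36–38; Balaban1989LargeFieldI, (0.2)–(0.4) p.176] -/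
theorem sLaw₁₃CoPH_all_of_chain_of_rows_of_rStepW (h : θ.Provisos₁₃CoPH F N) (hU : θ.ZhUnity F N) (hM : 1 ≤ θ.τ9.M) (hB₀ : 0 ≤ θ.s2.lf.B₀) :
    ∀ k, k ≤ p.K → SLaw₁₃CoPH F N θ p k := fun k hk =>
  (sLaw₁₃CoPH_iff F N θ p k).mpr ⟨_, _, formAtZS_chainWitness_of_rows_of_rStepW θ p σ hσloc huN hOE hpres hrows hRw h hU hM hB₀ k hk⟩

/-- **… AND THE 𝐓-IMAGE LAWS AT EVERY `k < K` from the suppliers' obligations + dag-n11-d's rows + (𝐑ʷ)** (§2's `tLaw₁₃CoPH_all_of_chain_of_rStepW` with the rows-derived clause).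
[cite: Balaban1988Convergent, Theorem p.245, remark p.262, §3 p.279, (3.24)–(3.25) p.270] -/
theorem tLaw₁₃CoPH_all_of_chain_of_rows_of_rStepW (h : θ.Provisos₁₃CoPH F N) (hU : θ.ZhUnity F N) (hM : 1 ≤ θ.τ9.M) (hB₀ : 0 ≤ θ.s2.lf.B₀) :
    ∀ k, k < p.K → TLaw₁₃CoPH F N θ p k :=
  tLaw₁₃CoPH_all_of_chain_of_rStepW θ p σ huN hOE hpres
    (fun k' hk' hform => noExpansionClauseFor_of_form_of_local_of_rows θ p h hU hk' hM _ _ hform (fun s₀ => isFluctLocal_chainWitness θ p σ hσloc k' s₀) (hrows k' hk' hform))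
    hRw hM hB₀

end Rows

/-! ## §4. Per windowed run: `B16.Thm1Printed` at the CoPH ∕ SepCoPH datum from the 𝐓-image laws at all levels and (𝐑ʷ) -/

section PerRun

/-- **`B16.Thm1Printed (datumOfRecord₁₃CoPH θ h).C` — [III] THEOREM 1 AT THE CoPH DATUM OF `θ` — FROM, PER WINDOWED RUN `P`, THE 𝐓-IMAGE LAWS AT ALL LEVELS (§2 ∕ §3's output along
the chain) AND (𝐑ʷ)** (def-T's `thm1Printed_datumOfRecord₁₃CoPH_of_tLaw_rOpLeaf`: the (S1ᵀ) laws hold outright, the leaf by §1).  Generic `θ`; `h` is only the datum's key.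
[cite: Balaban1988Convergent, Thm 1 p.262, Theorem p.245, p.244 L36–38; Balaban1989LargeFieldII, Thm 1 p.355 (not exercised)] -/
theorem thm1Printed_datumOfRecord₁₃CoPH_of_tLaw_all_of_rStepW (h : θ.Provisos₁₃CoPH F N) {γ : ℝ} (hγ : 0 < γ)
    (hT : ∀ P : B12.RunParams, ((datumOfRecord₁₃CoPH F N θ h).C P).flow.InInterval γ P.K → ∀ k, k < P.K → TLaw₁₃CoPH F N θ P k)
    (hRw : ∀ P : B12.RunParams, ((datumOfRecord₁₃CoPH F N θ h).C P).flow.InInterval γ P.K → ∀ k, k < P.K →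
      ∀ (tT : SeqOfRecord F θ.ν θ.τ9.M (gOfRecord₁₃ F N θ.toStage13Params P) P.K (k + 1) → Sect2.TermValues (F.P P.K) (MatA N) (FluctV N) θ.τ9.M)
        (EkT : SeqOfRecord F θ.ν θ.τ9.M (gOfRecord₁₃ F N θ.toStage13Params P) P.K (k + 1) → ℝ),
        HasSect2FormAtZS F N (FluctV N) P.K (settingOfRecord₁₃ F N θ.toStage13Params P) (k + 1) (θ.rzAt P) (WtOfRecord₁₃H F N θ P) (UbgOfRecord₁₃CoP F N θ.toStage13Params P (k + 1))
          (fun s u => Sect2.LawsT (sect2TowerOfRecord F N (FluctV N) P.K (settingOfRecord₁₃ F N θ.toStage13Params P) (θ.rzAt P s) s u) (settingOfRecord₁₃ F N θ.toStage13Params P).lf (settingOfRecord₁₃ F N θ.toStage13Params P).βc k)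
          (slotsTOfRecord F N θ.ν θ.τ9 (EOfRecord₁₃ F N θ.toStage13Params) (wOfRecord₉ F N θ.toStage9Params) θ.ppSel P (gOfRecord₁₃ F N θ.toStage13Params P) (k + 1)) tT EkT →
        HasSect2FormAtZS F N (FluctV N) P.K (settingOfRecord₁₃ F N θ.toStage13Params P) (k + 1) (θ.rzAt P) (WtOfRecord₁₃H F N θ P) (UbgOfRecord₁₃CoP F N θ.toStage13Params P (k + 1))
          (fun s u => Sect2.LawsRT (sect2TowerOfRecord F N (FluctV N) P.K (settingOfRecord₁₃ F N θ.toStage13Params P) (θ.rzAt P s) s u) (settingOfRecord₁₃ F N θ.toStage13Params P).lf (k + 1))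
          (slotsOfRecord F N θ.ν θ.τ9 (EOfRecord₁₃ F N θ.toStage13Params) (wOfRecord₉ F N θ.toStage9Params) θ.ppSel P (gOfRecord₁₃ F N θ.toStage13Params P) (k + 1)) tT EkT) :
    B16.Thm1Printed (datumOfRecord₁₃CoPH F N θ h).C :=
  thm1Printed_datumOfRecord₁₃CoPH_of_tLaw_rOpLeaf F N θ h hγ (fun P hP k hk _ => hT P hP k hk) fun P hP => rOpLeaf_of_rStepW θ P (hRw P hP)

/-- **`B16.Thm1Printed` AT THE v1.7 SEPARATED-RANGE DATUM `datumOfRecord₁₃SepCoPH θ h`** (`h : Provisos₁₃SepCoPH`, the K1⁷ item's key; `= datumOfRecord₁₃CoPH θ h.toCore` by `rfl`) from,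
per windowed run, the 𝐓-image laws at all levels and (𝐑ʷ). [cite: Balaban1988Convergent, Thm 1 p.262, Theorem p.245, p.244 L36–38; Balaban1989LargeFieldII, Thm 1 p.355 (not exercised)] -/
theorem thm1Printed_datumOfRecord₁₃SepCoPH_of_tLaw_all_of_rStepW (h : θ.Provisos₁₃SepCoPH F N) {γ : ℝ} (hγ : 0 < γ)
    (hT : ∀ P : B12.RunParams, ((datumOfRecord₁₃SepCoPH F N θ h).C P).flow.InInterval γ P.K → ∀ k, k < P.K → TLaw₁₃CoPH F N θ P k)
    (hRw : ∀ P : B12.RunParams, ((datumOfRecord₁₃SepCoPH F N θ h).C P).flow.InInterval γ P.K → ∀ k, k < P.K →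
      ∀ (tT : SeqOfRecord F θ.ν θ.τ9.M (gOfRecord₁₃ F N θ.toStage13Params P) P.K (k + 1) → Sect2.TermValues (F.P P.K) (MatA N) (FluctV N) θ.τ9.M)
        (EkT : SeqOfRecord F θ.ν θ.τ9.M (gOfRecord₁₃ F N θ.toStage13Params P) P.K (k + 1) → ℝ),
        HasSect2FormAtZS F N (FluctV N) P.K (settingOfRecord₁₃ F N θ.toStage13Params P) (k + 1) (θ.rzAt P) (WtOfRecord₁₃H F N θ P) (UbgOfRecord₁₃CoP F N θ.toStage13Params P (k + 1))
          (fun s u => Sect2.LawsT (sect2TowerOfRecord F N (FluctV N) P.K (settingOfRecord₁₃ F N θ.toStage13Params P) (θ.rzAt P s) s u) (settingOfRecord₁₃ F N θ.toStage13Params P).lf (settingOfRecord₁₃ F N θ.toStage13Params P).βc k)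
          (slotsTOfRecord F N θ.ν θ.τ9 (EOfRecord₁₃ F N θ.toStage13Params) (wOfRecord₉ F N θ.toStage9Params) θ.ppSel P (gOfRecord₁₃ F N θ.toStage13Params P) (k + 1)) tT EkT →
        HasSect2FormAtZS F N (FluctV N) P.K (settingOfRecord₁₃ F N θ.toStage13Params P) (k + 1) (θ.rzAt P) (WtOfRecord₁₃H F N θ P) (UbgOfRecord₁₃CoP F N θ.toStage13Params P (k + 1))
          (fun s u => Sect2.LawsRT (sect2TowerOfRecord F N (FluctV N) P.K (settingOfRecord₁₃ F N θ.toStage13Params P) (θ.rzAt P s) s u) (settingOfRecord₁₃ F N θ.toStage13Params P).lf (k + 1))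
          (slotsOfRecord F N θ.ν θ.τ9 (EOfRecord₁₃ F N θ.toStage13Params) (wOfRecord₉ F N θ.toStage9Params) θ.ppSel P (gOfRecord₁₃ F N θ.toStage13Params P) (k + 1)) tT EkT) :
    B16.Thm1Printed (datumOfRecord₁₃SepCoPH F N θ h).C :=
  thm1Printed_datumOfRecord₁₃CoPH_of_tLaw_all_of_rStepW θ h.toCore hγ hT hRw

end PerRun

end Summit.QuantumFields.YangMills.Theorems.BalabanUVNodesN11ThmP245OfSupplyChainRAssumedCoPH

end
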